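import Literature.Computability.AlgebraicComplexity.HenselLiftParityObstruction
import Literature.Computability.AlgebraicComplexity.SmallFormatMatMulRankCharTwoHensel
import HarnessLib

/-!
# Hensel lifting modulo `4` of `𝔽₂`-schemes: the table form `LiftsModFour` IS the tensor form `HenselLift.IsLift`; the `⟨4,5,5⟩:73` scheme in tensor form

Topic `Literature/Computability/AlgebraicComplexity`. This module joins the two formalisations of
the first 2-adic Hensel step of Kauers–Moosbauer 2022 §5 (arXiv:2212.01175, p. 10) that the tree
now holds:

* the TENSOR form `HenselLiftParityObstruction.lean` (2026-08-23): `HenselLift.IsLift P a`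
  (a family over `ℤ/4` reducing to the integer pattern `P` modulo `2`), certificates
  `HenselLift.Cert`, and the theorems `kauersMoosbauer2023_rank47_444_no_lift_mod4`,
  `kauersMoosbauer2023_rank60_445_no_lift_mod4` — the published `⟨4,4,4⟩:47` and `⟨4,4,5⟩:60`
  schemes over `ℤ₂` (`SchemeMod2_444`, `SchemeMod2_445` of `SmallFormatMatMulRankCharTwo.lean`) are
  not reductions of `⟨k,m,n⟩`-schemes over `ℤ/4`;
* the TABLE form `MatMulSchemeHenselLift.lean` / `SmallFormatMatMulRankCharTwoHensel.lean`
  (2026-08-30): `MatMulHenselLift.LiftsModFour k m n R c1 c2 c3` (integer tables congruent to the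
  `MatMulCellCheck` tables modulo `2` satisfying every Brent equation modulo `4`), bitmask
  certificates, and `SchemeMod2_444.not_liftsModFour`, `SchemeMod2_445.not_liftsModFour`,
  `SchemeMod2_455.not_liftsModFour` (the last one — the `⟨4,5,5⟩:73` scheme of
  Arai–Ichikawa–Hukushima 2024 — is not stated in print).

PROVENANCE, stated plainly: the table-form modules were written without knowledge of the tensor-form
module; for `⟨4,4,4⟩:47` and `⟨4,4,5⟩:60` they re-certify, by a different kernel procedure, exactly
what `HenselLiftParityObstruction.lean` had certified a week earlier. This file removes the
ambiguity: `liftsModFour_iff_exists_isLift` proves the two notions EQUIVALENT for every format and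
every table triple (so the library has one notion of "lifts modulo 4" with two decision procedures),
records the `444`/`445` table-form theorems as corollaries of the earlier tensor-form ones
(`SchemeMod2_444.not_liftsModFour_of_tensorForm`, `SchemeMod2_445.…`), and transports the one new
certificate to the tensor form: `SchemeMod2_455.no_lift_mod4` and
`SchemeMod2_455.not_reduction_of_int` (the `⟨4,5,5⟩:73` scheme over `ℤ₂` is not the reduction of
a `⟨4,5,5⟩`-scheme with `73` products over `ℤ/4`, in particular not of an integer one).

Everything here is proved; no named facts; no `decide`.

## References

* M. Kauers, J. Moosbauer, *Flip graphs for matrix multiplication*, ISSAC 2023 = arXiv:2212.01175,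
  §5 (Hensel lifting of `ℤ₂`-schemes; the non-liftability sentences for `(4,4,4)` and `(4,4,5)`).
  [KauersMoosbauer2022FlipGraphs]
* Y. Arai, K. Ichikawa, K. Hukushima, arXiv:2312.16960 (2024), the `⟨4,5,5⟩:73` scheme over `𝔽₂`
  (`SchemeMod2_455`). [AraiIchikawaHukushima2024]
* A. Fawzi et al., Nature 610 (2022) 47–53 (the `ℤ₂`-only `⟨4,4,4⟩:47` schemes). [FawziEtAl2022]
-/

open Finset

namespace Literature.Computability.AlgebraicComplexity

namespace MatMulHenselLift

open MatMulCellCheck HenselLift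

/-- The Brent right-hand side of `MatMulCellCheck` read in `ℤ/4` is the entry of `⟨k,m,n⟩` over `ℤ/4`
(same index convention: slot 1 = `(r,s)`, slot 2 = `(κ,μ)`, slot 3 = `(μ',ν)`). [cite: Blaser2013, §5] -/
theorem intCast_rhs_eq_matMulTensor {k m n : ℕ} (a : Fin k × Fin n) (b : Fin k × Fin m)
    (c : Fin m × Fin n) :
    ((rhs 1 a.1.val a.2.val b.1.val b.2.val c.1.val c.2.val : ℤ) : ZMod 4) =
      matMulTensor (ZMod 4) k m n a b c := by
  unfold rhs matMulTensor
  by_cases hc : a.1 = b.1 ∧ b.2 = c.1 ∧ a.2 = c.2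
  · have hc' : a.1.val = b.1.val ∧ b.2.val = c.1.val ∧ a.2.val = c.2.val :=
      ⟨by rw [hc.1], by rw [hc.2.1], by rw [hc.2.2]⟩
    rw [if_pos hc', if_pos hc, Int.cast_one]
  · have hc' : ¬ (a.1.val = b.1.val ∧ b.2.val = c.1.val ∧ a.2.val = c.2.val) :=
      fun h' => hc ⟨Fin.ext h'.1, Fin.ext h'.2.1, Fin.ext h'.2.2⟩
    rw [if_neg hc', if_neg hc, Int.cast_zero]

/-- Flat position `s + n·r` of `(r,s) ∈ k × n` lies below `k·n`. [folklore] -/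
private theorem flat_lt {k n : ℕ} (a : Fin k × Fin n) : a.2.val + n * a.1.val < k * n :=
  calc a.2.val + n * a.1.val < n + n * a.1.val := Nat.add_lt_add_right a.2.isLt _
    _ = n * (a.1.val + 1) := by ring
    _ ≤ n * k := Nat.mul_le_mul_left n a.1.isLt
    _ = k * n := Nat.mul_comm n k

/-- An integer table entry congruent modulo `2` to the pattern reduces, in `ℤ/4`, to a lift of the
pattern in the sense of `HenselLift.IsLift` — one entry. [cite: KauersMoosbauer2022FlipGraphs, §5] -/
theorem two_dvd_sub_iff_castHom (z P : ℤ) :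
    (2 : ℤ) ∣ z - P ↔ ZMod.castHom (show 2 ∣ 4 by norm_num) (ZMod 2) ((z : ℤ) : ZMod 4) = (P : ZMod 2) := by
  rw [map_intCast, ZMod.intCast_eq_intCast_iff_dvd_sub, dvd_sub_comm]
  norm_num

/-- UNFLATTENING: a lift `w` (tensor form, indexed by `Fin R` and `Fin k × Fin n`) of the pattern read
from a table `P` comes from an integer table `W : ℕ → ℕ → ℤ` congruent to `P` modulo `2` EVERYWHERE
(outside the format `W` simply copies `P`), whose reduction modulo `4` at the flat positions is `w`.
[cite: KauersMoosbauer2022FlipGraphs, §5] -/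
theorem exists_table_of_isLift {R k n : ℕ} (P : List (List ℤ)) (w : Fin R → Fin k × Fin n → ZMod 4)
    (hw : IsLift (fun (t : Fin R) (a : Fin k × Fin n) => tz P t.val (a.2.val + n * a.1.val)) w) :
    ∃ W : ℕ → ℕ → ℤ, (∀ t i, (2 : ℤ) ∣ W t i - tz P t i) ∧
      ∀ (t : Fin R) (a : Fin k × Fin n), ((W t.val (a.2.val + n * a.1.val) : ℤ) : ZMod 4) = w t a := by
  classical
  have hpos : ∀ {i : ℕ}, i < k * n → 0 < n := by
    intro i hi
    rcases Nat.eq_zero_or_pos n with h | h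
    · subst h; simp at hi
    · exact h
  refine ⟨fun t i => if h : t < R ∧ i < k * n then
      (((w ⟨t, h.1⟩ (⟨i / n, Nat.div_lt_of_lt_mul (by rw [Nat.mul_comm]; exact h.2)⟩,
        ⟨i % n, Nat.mod_lt i (hpos h.2)⟩)).val : ℕ) : ℤ) else tz P t i, ?_, ?_⟩
  · intro t i
    dsimp only
    by_cases h : t < R ∧ i < k * n
    · rw [dif_pos h, two_dvd_sub_iff_castHom, Int.cast_natCast, ZMod.natCast_zmod_val]
      have hl := (isLift_iff_castHom _ _).1 hw ⟨t, h.1⟩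
        (⟨i / n, Nat.div_lt_of_lt_mul (by rw [Nat.mul_comm]; exact h.2)⟩, ⟨i % n, Nat.mod_lt i (hpos h.2)⟩)
      dsimp only at hl
      rw [Nat.mod_add_div] at hl
      exact hl
    · rw [dif_neg h, sub_self]
      exact dvd_zero 2
  · rintro ⟨t, ht⟩ ⟨⟨r, hr⟩, ⟨s, hs⟩⟩
    have hi : s + n * r < k * n := flat_lt ((⟨r, hr⟩, ⟨s, hs⟩) : Fin k × Fin n)
    have hn : 0 < n := Fin.pos ⟨s, hs⟩
    have hq : (s + n * r) / n = r := by
      rw [Nat.add_mul_div_left _ _ hn, Nat.div_eq_of_lt hs, Nat.zero_add]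
    have hm : (s + n * r) % n = s := by
      rw [Nat.add_mul_mod_self_left, Nat.mod_eq_of_lt hs]
    dsimp only
    rw [dif_pos ⟨ht, hi⟩, Int.cast_natCast, ZMod.natCast_zmod_val]
    simp only [hq, hm]

/-- **The table form is the tensor form.** `LiftsModFour k m n R c1 c2 c3` (integer tables congruent
to `c1,c2,c3` modulo `2` satisfying all Brent equations of `⟨k,m,n⟩` modulo `4`) holds iff some
family over `ℤ/4` reducing modulo `2` to the patterns read from the tables
(`HenselLift.IsLift`, slots in flat positions `s + n·r`, `μ + m·κ`, `ν + n·μ'` exactly as in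
`KM444Z2.pW/pU/pV`) is a `⟨k,m,n⟩`-scheme with `R` products over `ℤ/4`. Hence every
`HenselLift.Cert` refutes `LiftsModFour` and every bitmask certificate of
`MatMulSchemeHenselLift.lean` refutes the tensor-form lift. [cite: KauersMoosbauer2022FlipGraphs, §5] -/
theorem liftsModFour_iff_exists_isLift (k m n R : ℕ) (c1 c2 c3 : List (List ℤ)) :
    LiftsModFour k m n R c1 c2 c3 ↔
      ∃ (w : Fin R → Fin k × Fin n → ZMod 4) (u : Fin R → Fin k × Fin m → ZMod 4)
        (v : Fin R → Fin m × Fin n → ZMod 4),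
        IsLift (fun (t : Fin R) (a : Fin k × Fin n) => tz c1 t.val (a.2.val + n * a.1.val)) w ∧
        IsLift (fun (t : Fin R) (b : Fin k × Fin m) => tz c2 t.val (b.2.val + m * b.1.val)) u ∧
        IsLift (fun (t : Fin R) (c : Fin m × Fin n) => tz c3 t.val (c.2.val + n * c.1.val)) v ∧
        matMulTensor (ZMod 4) k m n = ∑ t, triad (w t) (u t) (v t) := by
  constructor
  · rintro ⟨W, U, V, hW, hU, hV, hB⟩
    refine ⟨fun t a => ((W t.val (a.2.val + n * a.1.val) : ℤ) : ZMod 4),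
      fun t b => ((U t.val (b.2.val + m * b.1.val) : ℤ) : ZMod 4),
      fun t c => ((V t.val (c.2.val + n * c.1.val) : ℤ) : ZMod 4), ?_, ?_, ?_, ?_⟩
    · exact (isLift_iff_castHom _ _).2 fun t a => (two_dvd_sub_iff_castHom _ _).1 (hW _ _)
    · exact (isLift_iff_castHom _ _).2 fun t b => (two_dvd_sub_iff_castHom _ _).1 (hU _ _)
    · exact (isLift_iff_castHom _ _).2 fun t c => (two_dvd_sub_iff_castHom _ _).1 (hV _ _)
    · funext a b c
      rw [Finset.sum_apply, Finset.sum_apply, Finset.sum_apply]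
      simp only [triad_apply]
      have h4 := hB a.1.val a.2.val b.1.val b.2.val c.1.val c.2.val
        a.1.isLt a.2.isLt b.1.isLt b.2.isLt c.1.isLt c.2.isLt
      have hc : ((rhs 1 a.1.val a.2.val b.1.val b.2.val c.1.val c.2.val : ℤ) : ZMod 4) =
          ((∑ t ∈ range R, W t (a.2.val + n * a.1.val) * U t (b.2.val + m * b.1.val) *
            V t (c.2.val + n * c.1.val) : ℤ) : ZMod 4) :=
        (ZMod.intCast_eq_intCast_iff_dvd_sub _ _ 4).2 (by exact_mod_cast h4)
      rw [← intCast_rhs_eq_matMulTensor, hc, Int.cast_sum, ← Fin.sum_univ_eq_sum_range]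
      simp only [Int.cast_mul]
  · rintro ⟨w, u, v, hw, hu, hv, hT⟩
    obtain ⟨W, hW, hWv⟩ := exists_table_of_isLift c1 w hw
    obtain ⟨U, hU, hUv⟩ := exists_table_of_isLift c2 u hu
    obtain ⟨V, hV, hVv⟩ := exists_table_of_isLift c3 v hv
    refine ⟨W, U, V, hW, hU, hV, ?_⟩
    intro r s κ μ μ' ν hr hs hκ hμ hμ' hν
    have h := congrFun (congrFun (congrFun hT (⟨r, hr⟩, ⟨s, hs⟩)) (⟨κ, hκ⟩, ⟨μ, hμ⟩)) (⟨μ', hμ'⟩, ⟨ν, hν⟩)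
    rw [Finset.sum_apply, Finset.sum_apply, Finset.sum_apply] at h
    simp only [triad_apply] at h
    have hc := intCast_rhs_eq_matMulTensor (k := k) (m := m) (n := n)
      (⟨r, hr⟩, ⟨s, hs⟩) (⟨κ, hκ⟩, ⟨μ, hμ⟩) (⟨μ', hμ'⟩, ⟨ν, hν⟩)
    dsimp only at hc
    have hs' : ((∑ t ∈ range R, W t (s + n * r) * U t (μ + m * κ) * V t (ν + n * μ') : ℤ) : ZMod 4) =
        ∑ t : Fin R, w t (⟨r, hr⟩, ⟨s, hs⟩) * u t (⟨κ, hκ⟩, ⟨μ, hμ⟩) * v t (⟨μ', hμ'⟩, ⟨ν, hν⟩) := by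
      rw [Int.cast_sum, ← Fin.sum_univ_eq_sum_range]
      refine Finset.sum_congr rfl fun t _ => ?_
      have h1 := hWv t (⟨r, hr⟩, ⟨s, hs⟩)
      have h2 := hUv t (⟨κ, hκ⟩, ⟨μ, hμ⟩)
      have h3 := hVv t (⟨μ', hμ'⟩, ⟨ν, hν⟩)
      dsimp only at h1 h2 h3
      rw [Int.cast_mul, Int.cast_mul, h1, h2, h3]
    have h4 : ((∑ t ∈ range R, W t (s + n * r) * U t (μ + m * κ) * V t (ν + n * μ') : ℤ) : ZMod 4) =
        ((rhs 1 r s κ μ μ' ν : ℤ) : ZMod 4) := by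
      rw [hs', ← h, hc]
    have h5 := (ZMod.intCast_eq_intCast_iff_dvd_sub _ _ 4).1 h4.symm
    exact_mod_cast h5

end MatMulHenselLift

/-! ## §2 The `⟨4,4,4⟩:47` and `⟨4,4,5⟩:60` table-form theorems are corollaries of the tensor-form ones -/

section Corollaries

open MatMulCellCheck MatMulHenselLift

/-- `SchemeMod2_444.not_liftsModFour` (table form, `SmallFormatMatMulRankCharTwoHensel.lean`,
2026-08-30) follows from the EARLIER `kauersMoosbauer2023_rank47_444_no_lift_mod4`
(`HenselLiftParityObstruction.lean`, 2026-08-23) through `liftsModFour_iff_exists_isLift`: the two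
kernel certificates decide the same statement (`KM444Z2.pW/pU/pV` are the table patterns by
definition). [cite: KauersMoosbauer2022FlipGraphs, §5] -/
theorem SchemeMod2_444.not_liftsModFour_of_tensorForm :
    ¬ LiftsModFour 4 4 4 47 SchemeMod2_444.c1 SchemeMod2_444.c2 SchemeMod2_444.c3 := by
  intro h
  obtain ⟨w, u, v, hw, hu, hv, hT⟩ := (liftsModFour_iff_exists_isLift 4 4 4 47 _ _ _).1 h
  exact kauersMoosbauer2023_rank47_444_no_lift_mod4 ⟨w, u, v, hw, hu, hv, hT⟩

/-- `SchemeMod2_445.not_liftsModFour` (table form) follows from the earlier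
`kauersMoosbauer2023_rank60_445_no_lift_mod4` (tensor form) through `liftsModFour_iff_exists_isLift`.
[cite: KauersMoosbauer2022FlipGraphs, §5] -/
theorem SchemeMod2_445.not_liftsModFour_of_tensorForm :
    ¬ LiftsModFour 4 4 5 60 SchemeMod2_445.c1 SchemeMod2_445.c2 SchemeMod2_445.c3 := by
  intro h
  obtain ⟨w, u, v, hw, hu, hv, hT⟩ := (liftsModFour_iff_exists_isLift 4 4 5 60 _ _ _).1 h
  exact kauersMoosbauer2023_rank60_445_no_lift_mod4 ⟨w, u, v, hw, hu, hv, hT⟩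

/-! ## §3 The `⟨4,5,5⟩:73` scheme over `ℤ₂` (Arai–Ichikawa–Hukushima 2024) in tensor form -/

/-- The matrix multiplication tensor over `ℤ/4` is the reduction of the integer one (as in
`HenselLiftParityObstruction.lean`, where the lemma is private). [folklore] -/
private theorem matMulTensor_zmod_four' (k m n : ℕ) : matMulTensor (ZMod 4) k m n =
    fun a b c => ((matMulTensor ℤ k m n a b c : ℤ) : ZMod 4) := by
  funext a b c
  unfold matMulTensor
  split_ifs <;> simp

/-- **The `⟨4,5,5⟩:73` scheme over `ℤ₂` does not lift to `ℤ/4`** (tensor form of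
`SchemeMod2_455.not_liftsModFour`; NOT a statement in print — Kauers–Moosbauer report the
phenomenon for their `(4,4,4)`, `(4,4,5)`, `(5,5,5)` schemes; the first-order obstruction for this
scheme of Arai–Ichikawa–Hukushima was computed and kernel-certified in
`SmallFormatMatMulRankCharTwoHensel.lean`): no family over `ℤ/4` reducing modulo `2` to the scheme
(`SchemeMod2_455`, slots in flat positions `s + 5r`, `μ + 5κ`, `ν + 5μ'`) is a `⟨4,5,5⟩`-scheme over
`ℤ/4`. [cite: KauersMoosbauer2022FlipGraphs, §5 (the method; the scheme is that of AraiIchikawaHukushima2024)] -/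
theorem SchemeMod2_455.no_lift_mod4 :
    ¬ ∃ (w : Fin 73 → Fin 4 × Fin 5 → ZMod 4) (u : Fin 73 → Fin 4 × Fin 5 → ZMod 4)
      (v : Fin 73 → Fin 5 × Fin 5 → ZMod 4),
      HenselLift.IsLift
          (fun (t : Fin 73) (a : Fin 4 × Fin 5) => tz SchemeMod2_455.c1 t.val (a.2.val + 5 * a.1.val)) w ∧
        HenselLift.IsLift
          (fun (t : Fin 73) (b : Fin 4 × Fin 5) => tz SchemeMod2_455.c2 t.val (b.2.val + 5 * b.1.val)) u ∧
        HenselLift.IsLift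
          (fun (t : Fin 73) (c : Fin 5 × Fin 5) => tz SchemeMod2_455.c3 t.val (c.2.val + 5 * c.1.val)) v ∧
        matMulTensor (ZMod 4) 4 5 5 = ∑ t, triad (w t) (u t) (v t) :=
  fun h => SchemeMod2_455.not_liftsModFour ((liftsModFour_iff_exists_isLift 4 5 5 73 _ _ _).2 h)

/-- In particular the `⟨4,5,5⟩:73` scheme over `ℤ₂` is not the reduction modulo `2` of any INTEGER
`⟨4,5,5⟩`-scheme with `73` products (the analogue of
`kauersMoosbauer2023_rank47_444_not_reduction_of_int`).
[cite: KauersMoosbauer2022FlipGraphs, §5 (the method; the scheme is that of AraiIchikawaHukushima2024)] -/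
theorem SchemeMod2_455.not_reduction_of_int {w : Fin 73 → Fin 4 × Fin 5 → ℤ}
    {u : Fin 73 → Fin 4 × Fin 5 → ℤ} {v : Fin 73 → Fin 5 × Fin 5 → ℤ}
    (hw : ∀ t x, ((w t x : ℤ) : ZMod 2) =
      ((tz SchemeMod2_455.c1 t.val (x.2.val + 5 * x.1.val) : ℤ) : ZMod 2))
    (hu : ∀ t x, ((u t x : ℤ) : ZMod 2) =
      ((tz SchemeMod2_455.c2 t.val (x.2.val + 5 * x.1.val) : ℤ) : ZMod 2))
    (hv : ∀ t x, ((v t x : ℤ) : ZMod 2) =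
      ((tz SchemeMod2_455.c3 t.val (x.2.val + 5 * x.1.val) : ℤ) : ZMod 2)) :
    matMulTensor ℤ 4 5 5 ≠ ∑ t, triad (w t) (u t) (v t) := by
  intro h
  refine SchemeMod2_455.no_lift_mod4 ⟨_, _, _, HenselLift.isLift_intCast hw,
    HenselLift.isLift_intCast hu, HenselLift.isLift_intCast hv, ?_⟩
  rw [matMulTensor_zmod_four', h]
  funext a b c
  simp only [Finset.sum_apply, triad_apply, Int.cast_sum, Int.cast_mul]

end Corollaries

end Literature.Computability.AlgebraicComplexity
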